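import Summits.AtomisticToContinuum.Crystallization.Theorems.FreeSplittingCertificatesStrictSplittingRulePolytypeLedger
import Summits.AtomisticToContinuum.Crystallization.Theorems.FreeSplittingCertificatesStrictSplittingRuleHcpFamilyMinLocalised
import Summits.AtomisticToContinuum.Crystallization.Theorems.PricedLinkCensusStackingHingeLjRegistryDomination
import Summits.AtomisticToContinuum.Crystallization.Theorems.PhononSlackCertificatesPeriodicGivenLayeredRegistry

/-!
# `StrictSplittingRule` (stmt-AtomisticToContinuum-12560), line `polytype`: stub `stub_stackingLedger` (Z)

The zeroth-order stacking ledger of the Lennard-Jones interlayer registry couplings `J_k(a,h) = barlowCoupling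
lennardJones a h k` AT THE hcp-FAMILY MINIMISER: `HaggLedger (barlowCoupling lennardJones a h)` — the lattice-sum
comparison `e(hcp) < e(fcc)` (`J₂ < 0`) in the sitewise form the assembly of `F` consumes.

§1 finishes the abstract ledger (`…PolytypeLedger.lean` proved the forward balance): the BACKWARD balance of `s` at `m`
is the forward balance of the reflected sequence `i ↦ s(2m−1−i)` at `m` (`bwdBalance_eq_fwdBalance_reflect`), whence
`haggLedger_of_domination` (signs + summability + Hägg half-domination ⇒ `HaggLedger J`) and the explicit bank budgets
(`fwdBalance_bank_ge_eighth`, `bwdBalance_bank_ge_eighth`: a layer adjacent to a c-layer retains `≥ ⅛|J₂|` — the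
first-order budget of the assembly at exactly the layers that feel a net registry force).
§2 moves the landed certified facts to the minimiser: `hcpFamilyMin_enclosure` (`|a − 0.97129|, |h − 0.79294| ≤ 10⁻⁴`
⇒ the box `B = {47/50 ≤ a ≤ 1, 39a/50 ≤ h ≤ 17a/20}`), `LayeredHull.stub_registry` (`J_k = D_a(kh) ≤ 0`, `k ≥ 2`, via
`ljd_barlowCoupling_eq`), `PricedHcpWindowsJ2Neg.stub_J2neg`, `PricedHcpWindowsLjSummable.stub_ljSummable`,
`PricedHcpWindowsLjDomination.stub_ljDomination`, and concludes `stub_stackingLedger`.  All [folklore] bookkeeping.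
-/

noncomputable section

namespace Summit.AtomisticToContinuum.Crystallization.Theorems.StrictSplittingRuleBirth

open scoped BigOperators Classical
open Finset
open Literature.MathematicalPhysics.StatisticalMechanics

/-! ## §1  The backward balance by reflection; the ledger; bank budgets -/

section Backward

variable {J : ℕ → ℝ} {s : ℤ → ℤ}

/-- The reflection `i ↦ s(2m − 1 − i)` of a Hägg sequence is a Hägg sequence. [folklore] -/
theorem isHaggSeq_reflect (hs : IsHaggSeq s) (m : ℤ) : IsHaggSeq fun i => s (2 * m - 1 - i) := fun _ => hs _

/-- Backward windows are forward windows of the reflection: `window s (m − k) k = window s̃ m k`. [folklore] -/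
theorem haggWindow_reflect (s : ℤ → ℤ) (m : ℤ) (k : ℕ) :
    haggWindow (fun i => s (2 * m - 1 - i)) m k = haggWindow s (m - k) k := by
  unfold haggWindow
  rw [← Finset.sum_range_reflect (fun i : ℕ => s (m - k + i)) k]
  refine Finset.sum_congr rfl fun i hi => ?_
  rw [Finset.mem_range] at hi
  show s (2 * m - 1 - (m + (i : ℤ))) = s (m - (k : ℤ) + ((k - 1 - i : ℕ) : ℤ))
  congr 1
  have hc : ((k - 1 - i : ℕ) : ℤ) = (k : ℤ) - 1 - i := by omega
  rw [hc]; ring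

/-- Backward alignment is forward alignment of the reflection. [folklore] -/
theorem haggAligned_reflect (s : ℤ → ℤ) (m : ℤ) (k : ℕ) :
    HaggAligned (fun i => s (2 * m - 1 - i)) m k ↔ HaggAligned s (m - k) k := by
  unfold HaggAligned; rw [haggWindow_reflect]

/-- c-layers of the reflection: `IsCLayer s̃ (m + d) ↔ IsCLayer s (m − d)`. [folklore] -/
theorem isCLayer_reflect (s : ℤ → ℤ) (m d : ℤ) :
    IsCLayer (fun i => s (2 * m - 1 - i)) (m + d) ↔ IsCLayer s (m - d) := by
  unfold IsCLayer
  have e1 : 2 * m - 1 - (m + d - 1) = m - d := by ring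
  have e2 : 2 * m - 1 - (m + d) = m - d - 1 := by ring
  show s (2 * m - 1 - (m + d - 1)) = s (2 * m - 1 - (m + d)) ↔ s (m - d - 1) = s (m - d)
  rw [e1, e2, eq_comm]

/-- The backward balance of `s` at `m` is the forward balance of the reflection at `m`. [folklore] -/
theorem bwdBalance_eq_fwdBalance_reflect (J : ℕ → ℝ) (s : ℤ → ℤ) (m : ℤ) :
    bwdBalance J s m = fwdBalance J (fun i => s (2 * m - 1 - i)) m := by
  unfold bwdBalance fwdBalance
  have hloc : haggBackwardLocalEnergy J s m = haggLocalEnergy J (fun i => s (2 * m - 1 - i)) m := by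
    unfold haggBackwardLocalEnergy haggLocalEnergy
    refine tsum_congr fun k => ?_
    simp only [haggAligned_reflect]
  have hfirst : ∀ d : ℕ, IsFirstCBelow s m d ↔ IsFirstCAbove (fun i => s (2 * m - 1 - i)) m d := by
    intro d
    unfold IsFirstCBelow IsFirstCAbove
    simp only [isCLayer_reflect]
  have hbank : IsCLayer s (m - 1) ↔ IsCLayer (fun i => s (2 * m - 1 - i)) (m + 1) := by
    rw [show (m + 1 : ℤ) = m + ((1 : ℤ)) from rfl, isCLayer_reflect]
  rw [hloc]
  simp only [hfirst, hbank]

/-- **The backward balance is non-negative.** [folklore] -/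
theorem bwdBalance_nonneg (hneg : ∀ k, 2 ≤ k → J k ≤ 0) (hsum : Summable fun k : ℕ => (k : ℝ) * |J k|)
    (hdom : ∑' k : ℕ, (if 3 ≤ k then ((k : ℝ) - 1) * |J k| else 0) ≤ 1 / 2 * |J 2|)
    (hs : IsHaggSeq s) (m : ℤ) : 0 ≤ bwdBalance J s m := by
  rw [bwdBalance_eq_fwdBalance_reflect]
  exact fwdBalance_nonneg hneg hsum hdom (isHaggSeq_reflect hs m) m

end Backward

/-- **The zeroth-order stacking ledger from signs, summability and Hägg half-domination** (abstract form of stub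
`stub_stackingLedger`): for `J_k ≤ 0` (`k ≥ 2`), `J₂ < 0`, `Σ k|J_k| < ∞` and `Σ_{k≥3}(k−1)|J_k| ≤ ½|J₂|`, every layer
of every Hägg sequence has non-negative forward and backward balances. [folklore] -/
theorem haggLedger_of_domination {J : ℕ → ℝ} (hneg : ∀ k, 2 ≤ k → J k ≤ 0) (h2 : J 2 < 0)
    (hsum : Summable fun k : ℕ => (k : ℝ) * |J k|)
    (hdom : ∑' k : ℕ, (if 3 ≤ k then ((k : ℝ) - 1) * |J k| else 0) ≤ 1 / 2 * |J 2|) : HaggLedger J :=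
  ⟨h2, fun _ hs m => ⟨fwdBalance_nonneg hneg hsum hdom hs m, bwdBalance_nonneg hneg hsum hdom hs m⟩⟩


/-- **Bank budget (forward)**: under Hägg half-domination the layer just below a c-layer retains `≥ ⅛|J₂|` of forward
balance (beyond its outlay and its donation). [folklore] -/
theorem fwdBalance_bank_ge_eighth {J : ℕ → ℝ} {s : ℤ → ℤ} (hneg : ∀ k, 2 ≤ k → J k ≤ 0)
    (hsum : Summable fun k : ℕ => (k : ℝ) * |J k|)
    (hdom : ∑' k : ℕ, (if 3 ≤ k then ((k : ℝ) - 1) * |J k| else 0) ≤ 1 / 2 * |J 2|)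
    (hs : IsHaggSeq s) {m : ℤ} (hb : IsCLayer s (m + 1)) : |J 2| / 8 ≤ fwdBalance J s m := by
  have h1 := fwdBalance_bank_ge (hneg 2 le_rfl) (ledger_summable_abs hsum) hs hb
  have h2 := ledger_bank_sum_le (J := J) hsum
  linarith

/-- **Bank budget (backward)**: the layer just above a c-layer retains `≥ ⅛|J₂|` of backward balance. [folklore] -/
theorem bwdBalance_bank_ge_eighth {J : ℕ → ℝ} {s : ℤ → ℤ} (hneg : ∀ k, 2 ≤ k → J k ≤ 0)
    (hsum : Summable fun k : ℕ => (k : ℝ) * |J k|)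
    (hdom : ∑' k : ℕ, (if 3 ≤ k then ((k : ℝ) - 1) * |J k| else 0) ≤ 1 / 2 * |J 2|)
    (hs : IsHaggSeq s) {m : ℤ} (hb : IsCLayer s (m - 1)) : |J 2| / 8 ≤ bwdBalance J s m := by
  rw [bwdBalance_eq_fwdBalance_reflect]
  refine fwdBalance_bank_ge_eighth hneg hsum hdom (isHaggSeq_reflect hs m) ?_
  exact (isCLayer_reflect s m 1).2 hb

/-! ## §2  The Lennard-Jones couplings at the family minimiser -/

/-- The hcp-family minimiser lies in the certified box `47/50 ≤ a ≤ 1`, `39a/50 ≤ h ≤ 17a/20`. [folklore] -/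
theorem hcpFamilyMin_mem_box {a h : ℝ} (ha : 0 < a) (hh : 0 < h) (hfam : HcpFamilyMin a h) :
    47 / 50 ≤ a ∧ a ≤ 1 ∧ 39 / 50 * a ≤ h ∧ h ≤ 17 / 20 * a := by
  obtain ⟨hA, hH⟩ := hcpFamilyMin_enclosure ha hh hfam
  rw [abs_sub_le_iff] at hA hH
  obtain ⟨hA₁, hA₂⟩ := hA
  obtain ⟨hH₁, hH₂⟩ := hH
  refine ⟨by linarith, by linarith, by linarith, by linarith⟩

/-- On the box every interlayer registry coupling is non-positive: `J_k(a,h) ≤ 0` for `k ≥ 2` (indeed for `k h ≥ 39a/25`).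
[folklore] -/
theorem barlowCoupling_nonpos_of_mem_box {a h : ℝ} (ha : 47 / 50 ≤ a) (ha1 : a ≤ 1) (hh : 39 / 50 * a ≤ h)
    {k : ℕ} (hk : 2 ≤ k) : barlowCoupling lennardJones a h k ≤ 0 := by
  obtain ⟨_, -, hreg⟩ := LayeredHull.stub_registry
  have hmono := (hreg a ha ha1).1
  have hk' : (2 : ℝ) ≤ k := by exact_mod_cast hk
  have ha0 : 0 < a := by linarith
  have hH : 39 / 25 * a ≤ (k : ℝ) * h := by nlinarith
  rw [PricedHcpWindowsLjDomination.ljd_barlowCoupling_eq]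
  exact (hmono ((k : ℝ) * h) ((k : ℝ) * h) hH le_rfl).1

/-- **Z · stub_stackingLedger** (registered stub of line `polytype`): the zeroth-order stacking ledger of the
Lennard-Jones registry couplings holds at every hcp-family minimiser. [folklore] -/
theorem stub_stackingLedger :
    ∀ a h : ℝ, 0 < a → 0 < h → HcpFamilyMin a h → HaggLedger (barlowCoupling lennardJones a h) := by
  intro a h ha hh hfam
  obtain ⟨h1, h2, h3, h4⟩ := hcpFamilyMin_mem_box ha hh hfam
  obtain ⟨c₀, hc₀, hJ2⟩ := PricedHcpWindowsJ2Neg.stub_J2neg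
  exact haggLedger_of_domination (fun k hk => barlowCoupling_nonpos_of_mem_box h1 h2 h3 hk)
    (by linarith [hJ2 a h h1 h2 h3 h4]) (PricedHcpWindowsLjSummable.stub_ljSummable a h h1 h2 h3 h4)
    (PricedHcpWindowsLjDomination.stub_ljDomination a h h1 h2 h3 h4)

end Summit.AtomisticToContinuum.Crystallization.Theorems.StrictSplittingRuleBirth

end
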